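import Summits.BirchSwinnertonDyer.BirchSwinnertonDyer.Theorems.KatoDescentPotSupersingularMemberHullCoreInputsOfFine
import Summits.BirchSwinnertonDyer.BirchSwinnertonDyer.Theorems.KatoDescentPotSupersingularTowerTorsionFinite
import HarnessLib

/-!
# CRUX M AND U₀-red ON EVERY POTENTIALLY SUPERSINGULAR ROW FROM {modularity, `exists_memberHullZetaFineInputs`, H2X⁺,
# Ferrero–Washington, Lim 3.5} ALONE — NO Imai: the local finiteness at Kato's member is the TREE THEOREM
# `TowerTorsionFinite.finite_fixedPoints_kerSubgroup_inf_decomp_of_isIsogenous_of_potentiallySupersingular`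
# (route-free helper for crux M = stmt-BirchSwinnertonDyer-19196 `ReducibleKatoMember`, K9 / K8-t′; seat `bsd-potss-rkm` g31)

After seat g30 the held core package of M (27962 `Kato2004.exists_memberHullZetaCoreInputs`) is, in the kernel, a consequence
of {Fine, H2X⁺, FW, Lim} ⊕ Imai's finiteness `W_K(ℚ_{p,∞})[p^∞] < ∞` (`CoreInputsOfFine.exists_memberHullZetaCoreInputs_of_fineInputs`,
p677595; named form p678466).  The sibling file `…TowerTorsionFinite` (this seat, p680430) proves that finiteness on every
potentially SUPERSINGULAR row (Serre 1967 §5 Prop. 8 is a tree theorem — cell `bsd-wall`), at every isogenous member.  The two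
routes touch ONLY such rows: K9 applies M at `ClassO6 W 3` (wild `3`), K8-t′ at `Addv W p ∧ SubTprime W p` (census cell (t′)).
THIS FILE runs M's whole chain PER ROW with the kernel finiteness in place of Imai:

* §1 `katoMemberShaBoundSharp_at_of_fineInputs_of_towerFinite` — the per-row ENGINE: for a row `(W, p)` of M's domain (`W`
  globally minimal, `p ≠ 2` additive potentially good, `W[p]` reducible, `L(W,1) ≠ 0`, `Ш(W)` finite) and ANY source of the
  local finiteness at the curves isogenous to `W` (hypothesis `hfinIso`, cyclotomic `κ`), {modularity, Fine, H2X⁺, Lim, FW} give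
  Kato's member `W' ∼ W` with the SHARP bound `ord_p #Ш(W')[p^∞] + v_p Tam(W') ≤ ord_p(L(W',1)/Ω(W')) + 2·ord_p #W'(ℚ)_tors`
  (Fine at the row → modularity → the cyclotomic pin `(κ, γ, 𝐇¹_Γ, 𝐲)` (all PROVED existences) → the hull sub-package `Z` →
  `W'(ℚ)` finite by clause (b′) (`ZetaLineRankZero.finite_point_of_zetaLineOrthIndexAt`) → H2X⁺ at `W'` with `hfin := hfinIso` →
  the core package (`CoreInputsOfFine.nonempty_coreInputs_of_fineInputs`, μ by FW + Lim) → `sha_add_tamagawa_le_of_PT`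
  (Poitou–Tate over `ℚ` a tree theorem));
* §2 `…_of_potentiallySupersingular` — `hfinIso` DISCHARGED by the tree on every potentially supersingular row (`0 ≤ ord_p j`, no
  unit root at any good place above `p`): the sharp bound, M's ROW CONCLUSION verbatim (`3·ord_p #tors`, the body of
  `O6.KatoMemberShaBoundOfReducible` at `(W, p)`), and U₀-red's `MissingUpperBoundAt W p` at analytic rank `0` (with U₀-red's
  other held inputs Cassels / GZK / entire `L` displayed as in `ReducibleUpperOfCoreInputs.missingUpperBoundAt_of_coreInputs`);
* §3 THE ROUTES' ROWS: `…_of_classO6` (ALL K9 rows) and `…_of_subTprime` (ALL K8-t′ rows) — M's row conclusion and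
  `MissingUpperBoundAt` from {modularity, Fine, H2X⁺, FW, Lim} (+ Cassels/GZK/entire `L` for the latter), NO Imai, NO 27962;
* (sibling file `…ReducibleKatoMemberOfFineInputsImaiOrd`, this seat) the ∀-FACT level with the displayed Imai schema HALVED
  to the potentially ORDINARY rows: 27962, the O6 node and U₀-red from {Fine, H2X⁺, Lim, FW} ⊕ Imai's finiteness ONLY for
  curves having a unit root at some good place above `p` (the rows neither route touches).

HONEST FRAMING.  Theorems only (no definition, no named fact, no `sorry`); route-free (imports no K9/K8-t′ `Theses.*`); closes
nothing by itself: the item M = `O6.KatoMemberShaBoundOfReducible` ranges over ALL reducible additive potentially good rows,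
including the potentially ORDINARY ones, where Imai's finiteness is NOT a tree theorem — so M itself stays cite-level over
{modularity, Fine, H2X⁺, FW, Lim, Imai}.  What changes: on every row either ROUTE instantiates M (K9: `ClassO6`; K8-t′: (t′)),
M's conclusion and U₀-red's upper half now rest on {modularity, Fine, H2X⁺, FW, Lim} (+ Cassels/GZK for U₀-red) — Kato's
Euler-system theorems and classical facts — with NO local-torsion input.  BSD is proved for no curve; nothing is booked.

References: [Kato2004Asterisque] Thm. 12.5 (p. 222), Cor. 14.3 / Thm. 14.5 (pp. 235–236), (14.9.1)–(14.9.3) (pp. 239–240),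
§14.14 (14.14.1)–(14.14.2) (p. 243), Prop. 14.16 (2) (pp. 244–245), Lemma 14.18 (pp. 247–248); [Serre1967GroupesPDivisibles]
§5 Prop. 8; [Imai1975] Theorem (p. 12); [Wuthrich2014] Lemma 14 (p. 396); [Lim2017FineSelmer] Thm. 3.5; [FerreroWashington1979];
[Kim2022StructureSelmer] §3.2.3; [Cassels1965ArithmeticVIII]; tree: `…MemberHullCoreInputsOfFine` (rkm g30), `…TowerTorsionFinite`
(rkm g31), `…ReducibleUpperOfCoreInputs` / `…ZetaLineRankZero` (rkm g25), `PotentiallySupersingularLocalTowerTorsionFiniteHolds`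
(bsd-wall utd-p3 g5 / kmc g17).
-/

-- the summit and its single problem are both named `BirchSwinnertonDyer` (registry layout D-0017)
set_option linter.dupNamespace false
set_option autoImplicit false

noncomputable section

open scoped Classical NumberField TensorProduct
open Function Field NumberField IsDedekindDomain WeierstrassCurve CongruenceSubgroup
open Literature.NumberTheory.EllipticCurves Literature.NumberTheory.EllipticCurves.GreenbergSelmer
open Literature.NumberTheory.GaloisRepresentations Literature.NumberTheory.GaloisCohomology
open Literature.NumberTheory.EllipticCurves.ModularForms
open Literature.NumberTheory.EllipticCurves.Kato2004 Literature.NumberTheory.EllipticCurves.Kato2004.EulerSystemValues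
open Literature.NumberTheory.EllipticCurves.IwasawaAlgebra Literature.NumberTheory.EllipticCurves.IwasawaDual
open Literature.NumberTheory.EllipticCurves.Rank1Residual Literature.NumberTheory.EllipticCurves.Rank1Residual.Typed
open Summit.BirchSwinnertonDyer.Rank1Residual Summit.BirchSwinnertonDyer.Rank1Residual.Additive
open Summit.BirchSwinnertonDyer.BirchSwinnertonDyer.Theorems
open Summit.BirchSwinnertonDyer.BirchSwinnertonDyer.Theorems.IntegralH1LayerZeroTop
open Summit.BirchSwinnertonDyer.BirchSwinnertonDyer.Theorems.AdditivePotSupersingularControl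

universe u

namespace Summit.BirchSwinnertonDyer.BirchSwinnertonDyer.Theorems.FineInputsPotSupersingular

/-! ## §1 The per-row engine: Kato's member with the SHARP bound from {modularity, Fine, H2X⁺, Lim, FW} and ANY source of the
local finiteness at the member -/

/-- **Per row, the SHARP member bound from {modularity, Fine, H2X⁺, Lim 3.5, FW} and the local finiteness at the isogeny
class** (hypothesis `hfinIso`: `W'(ℚ̄)[p^∞]^{ker κ ⊓ D_v}` finite for every `W' ∼ W`, cyclotomic `κ`, `v ∣ p`).  For `W/ℚ` globally
minimal, `p ≠ 2` additive potentially good, `W[p]` reducible, `L(W,1) ≠ 0`, `Ш(W)` finite: Kato's member `W' ∼ W` with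
`ord_p #Ш(W')[p^∞] + v_p Tam(W') ≤ ord_p(L(W',1)/Ω(W')) + 2·ord_p #W'(ℚ)_tors`.  Chain: the hull sub-package at the row (Fine) →
a newform of `W` (modularity) → the cyclotomic pin (`exists_isCyclotomic_isTopGenerator_isCyclotomicVariable_holds`,
`nonempty_iwasawaH1Data_holds`, the unique lift `𝐲` of the zeta values) → `Z : MemberHullZetaFineInputs` → `W'(ℚ)` finite from
clause (b′) (Kato Thm. 14.5, `ZetaLineRankZero.finite_point_of_zetaLineOrthIndexAt`) → H2X⁺ at `W'` (its `hfin` = `hfinIso`) → the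
core package (`CoreInputsOfFine.nonempty_coreInputs_of_fineInputs`: μ by FW + Lim) → `MemberHullZetaCoreInputs.sha_add_tamagawa_le_of_PT`
(Prop. 14.16 (2) sharp, Poitou–Tate over `ℚ` PROVED).  NO Gross–Zagier–Kolyvagin, NO Imai.
[cite: Kato2004Asterisque, Thm. 12.5 (3) (p. 222), Thm. 14.5 (pp. 235–236), (14.9.1) (p. 239), §14.14 (p. 243), Prop. 14.16 (2) (pp. 244–245)]
[cite: Wuthrich2014, Lemma 14 (p. 396)] [cite: MilneADT2006, Ch. I, Thm. 4.10 (b)] -/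
theorem katoMemberShaBoundSharp_at_of_fineInputs_of_towerFinite (hmod : exists_isNewformOf)
    (hF : exists_memberHullZetaFineInputs) (hH : exists_iwasawaH2Data_fineSelmerDual_embedding_count)
    (hLim : Lim2017.thm35_fineSelmerDual_moduleFinite_of_classicalMuVanishes_of_le_divisionField)
    (hFW : Literature.NumberTheory.IwasawaTheory.ferreroWashington1979_classicalMuVanishes)
    (W : WeierstrassCurve ℚ) [W.IsElliptic] [W.IsGloballyMinimal] (p : ℕ) [Fact p.Prime]
    (hp : p ≠ 2) (hng : ¬ W.HasGoodReductionAtPrime p) (hnm : ¬ W.HasMultiplicativeReductionAtPrime p)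
    (hj : 0 ≤ padicValRat p W.j) (hred : ¬ W.HasIrreducibleModPGaloisRep p)
    (hL : W.entireLFunction 1 ≠ 0) (hsha : Finite W.sha)
    (hfinIso : ∀ (W' : WeierstrassCurve ℚ) [W'.IsElliptic], IsIsogenous W W' →
      ∀ (κ : ZpExtension ℚ p) (v : HeightOneSpectrum (𝓞 ℚ)), κ.IsCyclotomic →
        ((Rat.HeightOneSpectrum.primesEquiv v : Nat.Primes) : ℕ) = p →
        Finite (FixedPoints.addSubgroup ↥(κ.kerSubgroup ⊓ decomp v) (W'.geomPrimaryTorsion p))) :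
    ∃ (W' : WeierstrassCurve ℚ) (_ : W'.IsElliptic) (_ : W'.IsGloballyMinimal),
      IsIsogenous W W' ∧ Finite W'.sha ∧
      ∃ q : ℚ, W'.entireLFunction 1 / (W'.realPeriodRat : ℂ) = (q : ℂ) ∧
        (padicValNat p (Nat.card (AddCommGroup.primaryComponent W'.sha p)) : ℤ) +
            padicValNat p W'.tamagawaProduct ≤
          padicValRat p q + 2 * (padicValNat p W'.torsionOrder : ℤ) := by
  have hpp : p.Prime := Fact.out
  have hPT : poitouTate_selmerStructure_duality ℚ :=
    poitouTate_selmerStructure_duality_of_conj (InputsPoitouTateSelmer.poitouTate_selmerStructure_duality_conj_holds ℚ)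
  -- Kato's member `W'` and the hull sub-package data at it (Fine at the row)
  obtain ⟨W', hW'e, hW'm, hiso, hrest⟩ := hF W p hp hng hnm hj hred hL hsha
  haveI := hW'e
  haveI := hW'm
  haveI : ContinuousSMul ℤ_[p] (W'.tateModule p) := TateModule.continuousSMul_padicInt
  haveI : Module.Free ℤ_[p] (W'.tateModule p) := W'.module_free_tateModule_holds p
  haveI : Module.Finite ℤ_[p] (W'.tateModule p) := W'.module_finite_tateModule_holds p
  have hred' : ¬ W'.HasIrreducibleModPGaloisRep p :=
    Rank1Residual.not_hasIrreducibleModPGaloisRep_of_isIsogenous hiso hred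
  have hshaW' : Finite W'.sha := (IsIsogenous.shaFinite_iff_shaFinite hiso).mp hsha
  haveI : Finite W'.sha := hshaW'
  -- a newform of `W` (modularity) and a family of complex embeddings of the cyclotomic fields
  haveI : NeZero (W.conductorNorm ℤ) := ⟨(W.conductorNorm_pos_holds).ne'⟩
  obtain ⟨f, hf⟩ := hmod W
  obtain ⟨κ', Λ', c, d, a, A, z, x, -, -, -, -, hZB, hall⟩ := hrest f hf (fun m => Classical.arbitrary _)
  -- the cyclotomic pin: `κ`, a topological generator `γ`, the pinned `𝐇¹_Γ(T_pW')`, the lift `𝐲` of the zeta values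
  obtain ⟨κ, hκ, γ, hγ, -⟩ := exists_isCyclotomic_isTopGenerator_isCyclotomicVariable_holds p
  obtain ⟨I⟩ := Kato2004.nonempty_iwasawaH1Data_holds W' p κ γ hκ hγ
  obtain ⟨y, hy⟩ :=
    (IwasawaH1Data.existsUnique_lift_of_zetaBody p W' hκ hp I f _ κ' Λ' c d a A z x hZB).exists
  obtain ⟨Z⟩ := hall κ γ hκ hγ I y hy
  -- the place of `ℚ` at `p` and the local finiteness at the member (hypothesis `hfinIso`)
  let v : HeightOneSpectrum (𝓞 ℚ) := Rat.HeightOneSpectrum.primesEquiv.symm ⟨p, hpp⟩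
  have hv : ((Rat.HeightOneSpectrum.primesEquiv v : Nat.Primes) : ℕ) = p := by
    simp only [v, Equiv.apply_symm_apply]
  have hfin := hfinIso W' hiso κ v hκ hv
  -- `W'(ℚ)` finite from clause (b′) of the hull sub-package; `Ш(W')[p^∞]` finite
  haveI : Finite W'.toAffine.Point := by
    obtain ⟨q, -, e, -, hZL⟩ := Z.zetaLineIndex
    exact ZetaLineRankZero.finite_point_of_zetaLineOrthIndexAt W' p hPT hp
      (layerZeroToTop_mem_integralH1 W' p κ (I.proj_mem 0 y)) hZL
  haveI : Finite (AddCommGroup.primaryComponent W'.sha p) := inferInstance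
  -- H2X⁺ at the member, the core package, and the sharp count
  obtain ⟨J, eX, heX, hcokX, hc⟩ := hH W' p κ γ hγ v hp hκ hv hfin I
  obtain ⟨Zc⟩ := CoreInputsOfFine.nonempty_coreInputs_of_fineInputs W' p hLim hFW hp hκ hγ hred' Z J eX heX
    hcokX (hc inferInstance inferInstance)
  exact ⟨W', hW'e, hW'm, hiso, hshaW', Zc.sha_add_tamagawa_le_of_PT hκ hγ hPT hp⟩

/-- **Per row, M's conclusion (`3·ord_p #tors`, the body of `O6.KatoMemberShaBoundOfReducible` at `(W, p)`) from the same inputs**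
(the sharp bound weakened by `ord_p #tors ≥ 0`). [cite: Kato2004Asterisque, Prop. 14.16 (2) (pp. 244–245)] -/
theorem katoMemberShaBound_at_of_fineInputs_of_towerFinite (hmod : exists_isNewformOf)
    (hF : exists_memberHullZetaFineInputs) (hH : exists_iwasawaH2Data_fineSelmerDual_embedding_count)
    (hLim : Lim2017.thm35_fineSelmerDual_moduleFinite_of_classicalMuVanishes_of_le_divisionField)
    (hFW : Literature.NumberTheory.IwasawaTheory.ferreroWashington1979_classicalMuVanishes)
    (W : WeierstrassCurve ℚ) [W.IsElliptic] [W.IsGloballyMinimal] (p : ℕ) [Fact p.Prime]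
    (hp : p ≠ 2) (hng : ¬ W.HasGoodReductionAtPrime p) (hnm : ¬ W.HasMultiplicativeReductionAtPrime p)
    (hj : 0 ≤ padicValRat p W.j) (hred : ¬ W.HasIrreducibleModPGaloisRep p)
    (hL : W.entireLFunction 1 ≠ 0) (hsha : Finite W.sha)
    (hfinIso : ∀ (W' : WeierstrassCurve ℚ) [W'.IsElliptic], IsIsogenous W W' →
      ∀ (κ : ZpExtension ℚ p) (v : HeightOneSpectrum (𝓞 ℚ)), κ.IsCyclotomic →
        ((Rat.HeightOneSpectrum.primesEquiv v : Nat.Primes) : ℕ) = p →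
        Finite (FixedPoints.addSubgroup ↥(κ.kerSubgroup ⊓ decomp v) (W'.geomPrimaryTorsion p))) :
    ∃ (W' : WeierstrassCurve ℚ) (_ : W'.IsElliptic) (_ : W'.IsGloballyMinimal),
      IsIsogenous W W' ∧ Finite W'.sha ∧
      ∃ q : ℚ, W'.entireLFunction 1 / (W'.realPeriodRat : ℂ) = (q : ℂ) ∧
        (padicValNat p (Nat.card (AddCommGroup.primaryComponent W'.sha p)) : ℤ) +
            padicValNat p W'.tamagawaProduct ≤
          padicValRat p q + 3 * (padicValNat p W'.torsionOrder : ℤ) := by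
  obtain ⟨W', hW'e, hW'm, hiso, hshaW', q, hq, hle⟩ :=
    katoMemberShaBoundSharp_at_of_fineInputs_of_towerFinite hmod hF hH hLim hFW W p hp hng hnm hj hred hL hsha hfinIso
  refine ⟨W', hW'e, hW'm, hiso, hshaW', q, hq, ?_⟩
  have ht : (0 : ℤ) ≤ (padicValNat p W'.torsionOrder : ℤ) := by exact_mod_cast Nat.zero_le _
  linarith

/-- **Per row, U₀-red's `MissingUpperBoundAt W p` at analytic rank `0` from the same inputs** (+ U₀-red's other held inputs
Cassels `bsdRHS_eq_of_isIsogenous`, GZK, entire `L`, displayed as in `ReducibleUpperOfCoreInputs.missingUpperBoundAt_of_coreInputs`):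
the sharp bound at `W'` is `ord_p #Ш(W') ≤ ord_p #Ш_an(W')` (`exists_shaAn_eq_of_exactCount`), transported to `W` by Cassels
(`TwistComparison.missingUpperBoundAt_of_isIsogenous`). [cite: Kato2004Asterisque, proof of Prop. 14.16 (pp. 244–245)]
[cite: Cassels1965ArithmeticVIII] -/
theorem missingUpperBoundAt_of_fineInputs_of_towerFinite (hmod : exists_isNewformOf)
    (hF : exists_memberHullZetaFineInputs) (hH : exists_iwasawaH2Data_fineSelmerDual_embedding_count)
    (hLim : Lim2017.thm35_fineSelmerDual_moduleFinite_of_classicalMuVanishes_of_le_divisionField)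
    (hFW : Literature.NumberTheory.IwasawaTheory.ferreroWashington1979_classicalMuVanishes)
    (hCassels : bsdRHS_eq_of_isIsogenous) (hGZK : rank_eq_analyticRank_of_analyticRank_le_one)
    (hmodL : hasEntireLFunction_rat)
    (W : WeierstrassCurve ℚ) [W.IsElliptic] [W.IsGloballyMinimal] (p : ℕ) [Fact p.Prime]
    (hp : p ≠ 2) (hng : ¬ W.HasGoodReductionAtPrime p) (hnm : ¬ W.HasMultiplicativeReductionAtPrime p)
    (hj : 0 ≤ padicValRat p W.j) (hred : ¬ W.HasIrreducibleModPGaloisRep p)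
    (hr : W.analyticRank = 0)
    (hfinIso : ∀ (W' : WeierstrassCurve ℚ) [W'.IsElliptic], IsIsogenous W W' →
      ∀ (κ : ZpExtension ℚ p) (v : HeightOneSpectrum (𝓞 ℚ)), κ.IsCyclotomic →
        ((Rat.HeightOneSpectrum.primesEquiv v : Nat.Primes) : ℕ) = p →
        Finite (FixedPoints.addSubgroup ↥(κ.kerSubgroup ⊓ decomp v) (W'.geomPrimaryTorsion p))) :
    MissingUpperBoundAt W p := by
  have hL : W.entireLFunction 1 ≠ 0 := (W.analyticRank_eq_zero_iff_holds (hmodL W)).mp hr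
  have hsha : Finite W.sha := (hGZK W (by rw [hr]; exact zero_le_one)).2
  obtain ⟨W', hE', hM', hiso, hfin', q, hq, hle⟩ :=
    katoMemberShaBoundSharp_at_of_fineInputs_of_towerFinite hmod hF hH hLim hFW W p hp hng hnm hj hred hL hsha hfinIso
  haveI := hE'
  haveI := hM'
  have hr' : W'.analyticRank = 0 := by rw [← analyticRank_eq_of_isIsogenous' hiso, hr]
  -- bookkeeping at `W'`: the slack of the sharp inequality is the defect `ord Ш_an − ord Ш`
  obtain ⟨q', hq', hv⟩ := exists_shaAn_eq_of_exactCount W' p hGZK hmodL hr' (b := 0)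
    (a := padicValRat p q + 2 * (padicValNat p W'.torsionOrder : ℤ) -
      ((padicValNat p (Nat.card (AddCommGroup.primaryComponent W'.sha p)) : ℤ) +
        padicValNat p W'.tamagawaProduct)) hq (by ring)
  have hup' : MissingUpperBoundAt W' p := ⟨q', hq', by rw [hv]; linarith⟩
  exact TwistComparison.missingUpperBoundAt_of_isIsogenous W' W p hCassels hGZK hmodL
    hiso.symm_of_isElliptic (by rw [hr']; exact zero_le_one) hup'

/-! ## §2 Every potentially SUPERSINGULAR row: the local finiteness is the tree theorem of `…TowerTorsionFinite` -/

/-- **Per POTENTIALLY SUPERSINGULAR row, the SHARP member bound from {modularity, Fine, H2X⁺, Lim, FW} — NO Imai** (`hfinIso`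
discharged by `TowerTorsionFinite.finite_fixedPoints_kerSubgroup_inf_decomp_of_isIsogenous_of_potentiallySupersingular`: Serre
1967 §5 Prop. 8, a tree theorem, transported along `W ∼ W'`). [cite: Kato2004Asterisque, Prop. 14.16 (2) (pp. 244–245)]
[cite: Serre1967GroupesPDivisibles, §5 Prop. 8] -/
theorem katoMemberShaBoundSharp_at_of_fineInputs_of_potentiallySupersingular (hmod : exists_isNewformOf)
    (hF : exists_memberHullZetaFineInputs) (hH : exists_iwasawaH2Data_fineSelmerDual_embedding_count)
    (hLim : Lim2017.thm35_fineSelmerDual_moduleFinite_of_classicalMuVanishes_of_le_divisionField)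
    (hFW : Literature.NumberTheory.IwasawaTheory.ferreroWashington1979_classicalMuVanishes)
    (W : WeierstrassCurve ℚ) [W.IsElliptic] [W.IsGloballyMinimal] (p : ℕ) [Fact p.Prime]
    (hp : p ≠ 2) (hng : ¬ W.HasGoodReductionAtPrime p) (hnm : ¬ W.HasMultiplicativeReductionAtPrime p)
    (hj : 0 ≤ padicValRat p W.j) (hred : ¬ W.HasIrreducibleModPGaloisRep p)
    (hL : W.entireLFunction 1 ≠ 0) (hsha : Finite W.sha)
    (hss : ∀ (F : Type) [Field F] [NumberField F] (w : HeightOneSpectrum (𝓞 F)),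
      ((p : ℕ) : 𝓞 F) ∈ w.asIdeal → (W.baseChange F).HasGoodReductionAt w →
        ¬ (W.baseChange F).HasUnitRootAt w) :
    ∃ (W' : WeierstrassCurve ℚ) (_ : W'.IsElliptic) (_ : W'.IsGloballyMinimal),
      IsIsogenous W W' ∧ Finite W'.sha ∧
      ∃ q : ℚ, W'.entireLFunction 1 / (W'.realPeriodRat : ℂ) = (q : ℂ) ∧
        (padicValNat p (Nat.card (AddCommGroup.primaryComponent W'.sha p)) : ℤ) +
            padicValNat p W'.tamagawaProduct ≤
          padicValRat p q + 2 * (padicValNat p W'.torsionOrder : ℤ) :=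
  katoMemberShaBoundSharp_at_of_fineInputs_of_towerFinite hmod hF hH hLim hFW W p hp hng hnm hj hred hL hsha
    fun _ _ hiso κ v _ hv ↦
      TowerTorsionFinite.finite_fixedPoints_kerSubgroup_inf_decomp_of_isIsogenous_of_potentiallySupersingular
        W p hp hj hss hiso κ v hv

/-- **Per POTENTIALLY SUPERSINGULAR row, crux M's ROW CONCLUSION (the body of `O6.KatoMemberShaBoundOfReducible` at `(W, p)`)
from {modularity, Fine, H2X⁺, Lim, FW} — NO Imai, NO 27962.** [cite: Kato2004Asterisque, Prop. 14.16 (2) (pp. 244–245), Thm. 12.6 (p. 222)]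
[cite: Serre1967GroupesPDivisibles, §5 Prop. 8] [cite: Wuthrich2014, Lemma 14 (p. 396)] -/
theorem katoMemberShaBound_at_of_fineInputs_of_potentiallySupersingular (hmod : exists_isNewformOf)
    (hF : exists_memberHullZetaFineInputs) (hH : exists_iwasawaH2Data_fineSelmerDual_embedding_count)
    (hLim : Lim2017.thm35_fineSelmerDual_moduleFinite_of_classicalMuVanishes_of_le_divisionField)
    (hFW : Literature.NumberTheory.IwasawaTheory.ferreroWashington1979_classicalMuVanishes)
    (W : WeierstrassCurve ℚ) [W.IsElliptic] [W.IsGloballyMinimal] (p : ℕ) [Fact p.Prime]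
    (hp : p ≠ 2) (hng : ¬ W.HasGoodReductionAtPrime p) (hnm : ¬ W.HasMultiplicativeReductionAtPrime p)
    (hj : 0 ≤ padicValRat p W.j) (hred : ¬ W.HasIrreducibleModPGaloisRep p)
    (hL : W.entireLFunction 1 ≠ 0) (hsha : Finite W.sha)
    (hss : ∀ (F : Type) [Field F] [NumberField F] (w : HeightOneSpectrum (𝓞 F)),
      ((p : ℕ) : 𝓞 F) ∈ w.asIdeal → (W.baseChange F).HasGoodReductionAt w →
        ¬ (W.baseChange F).HasUnitRootAt w) :
    ∃ (W' : WeierstrassCurve ℚ) (_ : W'.IsElliptic) (_ : W'.IsGloballyMinimal),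
      IsIsogenous W W' ∧ Finite W'.sha ∧
      ∃ q : ℚ, W'.entireLFunction 1 / (W'.realPeriodRat : ℂ) = (q : ℂ) ∧
        (padicValNat p (Nat.card (AddCommGroup.primaryComponent W'.sha p)) : ℤ) +
            padicValNat p W'.tamagawaProduct ≤
          padicValRat p q + 3 * (padicValNat p W'.torsionOrder : ℤ) :=
  katoMemberShaBound_at_of_fineInputs_of_towerFinite hmod hF hH hLim hFW W p hp hng hnm hj hred hL hsha
    fun _ _ hiso κ v _ hv ↦
      TowerTorsionFinite.finite_fixedPoints_kerSubgroup_inf_decomp_of_isIsogenous_of_potentiallySupersingular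
        W p hp hj hss hiso κ v hv

/-- **Per POTENTIALLY SUPERSINGULAR row of analytic rank `0`, U₀-red's `MissingUpperBoundAt W p` from {modularity, Fine, H2X⁺,
Lim, FW} + Cassels / GZK / entire `L` — NO Imai, NO 27962.** [cite: Kato2004Asterisque, proof of Prop. 14.16 (pp. 244–245)]
[cite: Serre1967GroupesPDivisibles, §5 Prop. 8] [cite: Cassels1965ArithmeticVIII] -/
theorem missingUpperBoundAt_of_fineInputs_of_potentiallySupersingular (hmod : exists_isNewformOf)
    (hF : exists_memberHullZetaFineInputs) (hH : exists_iwasawaH2Data_fineSelmerDual_embedding_count)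
    (hLim : Lim2017.thm35_fineSelmerDual_moduleFinite_of_classicalMuVanishes_of_le_divisionField)
    (hFW : Literature.NumberTheory.IwasawaTheory.ferreroWashington1979_classicalMuVanishes)
    (hCassels : bsdRHS_eq_of_isIsogenous) (hGZK : rank_eq_analyticRank_of_analyticRank_le_one)
    (hmodL : hasEntireLFunction_rat)
    (W : WeierstrassCurve ℚ) [W.IsElliptic] [W.IsGloballyMinimal] (p : ℕ) [Fact p.Prime]
    (hp : p ≠ 2) (hng : ¬ W.HasGoodReductionAtPrime p) (hnm : ¬ W.HasMultiplicativeReductionAtPrime p)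
    (hj : 0 ≤ padicValRat p W.j) (hred : ¬ W.HasIrreducibleModPGaloisRep p) (hr : W.analyticRank = 0)
    (hss : ∀ (F : Type) [Field F] [NumberField F] (w : HeightOneSpectrum (𝓞 F)),
      ((p : ℕ) : 𝓞 F) ∈ w.asIdeal → (W.baseChange F).HasGoodReductionAt w →
        ¬ (W.baseChange F).HasUnitRootAt w) :
    MissingUpperBoundAt W p :=
  missingUpperBoundAt_of_fineInputs_of_towerFinite hmod hF hH hLim hFW hCassels hGZK hmodL W p hp hng hnm hj hred hr
    fun _ _ hiso κ v _ hv ↦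
      TowerTorsionFinite.finite_fixedPoints_kerSubgroup_inf_decomp_of_isIsogenous_of_potentiallySupersingular
        W p hp hj hss hiso κ v hv

/-! ## §3 The routes' rows: ALL of K9 (`ClassO6 W 3`) and ALL of K8-t′ (`Addv W p ∧ SubTprime W p`) -/

/-- **Crux M's row conclusion on EVERY K9 row (the wild class O6 at `3`) from {modularity, Fine, H2X⁺, Lim, FW} — NO Imai, NO 27962**
(`ClassO6 ⟹ 3 ≠ 2 ∧ Addv W 3 ∧ ord₃ j ≥ 0`, potentially supersingular by `not_hasUnitRootAt_baseChange_of_not_typeG_three`; the row's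
remaining hypotheses `W[3]` reducible, `L(W,1) ≠ 0`, `Ш(W)` finite as in M). This is exactly what `WildRankZeroAssembly` consumes of M.
[cite: Kato2004Asterisque, Prop. 14.16 (2) (pp. 244–245), Thm. 12.6 (p. 222)] [cite: Serre1967GroupesPDivisibles, §5 Prop. 8]
[cite: Delbourgo1998, §1.5 (G)] -/
theorem katoMemberShaBound_at_of_fineInputs_of_classO6 (hmod : exists_isNewformOf)
    (hF : exists_memberHullZetaFineInputs) (hH : exists_iwasawaH2Data_fineSelmerDual_embedding_count)
    (hLim : Lim2017.thm35_fineSelmerDual_moduleFinite_of_classicalMuVanishes_of_le_divisionField)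
    (hFW : Literature.NumberTheory.IwasawaTheory.ferreroWashington1979_classicalMuVanishes)
    (W : WeierstrassCurve ℚ) [W.IsElliptic] [W.IsGloballyMinimal] [Fact (3 : ℕ).Prime] (hO6 : ClassO6 W 3)
    (hred : ¬ W.HasIrreducibleModPGaloisRep 3) (hL : W.entireLFunction 1 ≠ 0) (hsha : Finite W.sha) :
    ∃ (W' : WeierstrassCurve ℚ) (_ : W'.IsElliptic) (_ : W'.IsGloballyMinimal),
      IsIsogenous W W' ∧ Finite W'.sha ∧
      ∃ q : ℚ, W'.entireLFunction 1 / (W'.realPeriodRat : ℂ) = (q : ℂ) ∧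
        (padicValNat 3 (Nat.card (AddCommGroup.primaryComponent W'.sha 3)) : ℤ) +
            padicValNat 3 W'.tamagawaProduct ≤
          padicValRat 3 q + 3 * (padicValNat 3 W'.torsionOrder : ℤ) :=
  katoMemberShaBound_at_of_fineInputs_of_potentiallySupersingular hmod hF hH hLim hFW W 3 (by decide)
    hO6.2.1.1 hO6.2.1.2 hO6.padicValRat_j_nonneg hred hL hsha
    (fun _F _ _ _w hw hgood ↦
      not_hasUnitRootAt_baseChange_of_not_typeG_three W hO6.2.1 hO6.not_typeG_three.1 hw hgood)

/-- **U₀-red's `MissingUpperBoundAt W 3` on EVERY K9 row of analytic rank `0` with `W[3]` reducible, from {modularity, Fine, H2X⁺,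
Lim, FW} + Cassels / GZK / entire `L` — NO Imai, NO 27962.** [cite: Kato2004Asterisque, proof of Prop. 14.16 (pp. 244–245)]
[cite: Serre1967GroupesPDivisibles, §5 Prop. 8] [cite: Cassels1965ArithmeticVIII] -/
theorem missingUpperBoundAt_of_fineInputs_of_classO6 (hmod : exists_isNewformOf)
    (hF : exists_memberHullZetaFineInputs) (hH : exists_iwasawaH2Data_fineSelmerDual_embedding_count)
    (hLim : Lim2017.thm35_fineSelmerDual_moduleFinite_of_classicalMuVanishes_of_le_divisionField)
    (hFW : Literature.NumberTheory.IwasawaTheory.ferreroWashington1979_classicalMuVanishes)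
    (hCassels : bsdRHS_eq_of_isIsogenous) (hGZK : rank_eq_analyticRank_of_analyticRank_le_one)
    (hmodL : hasEntireLFunction_rat)
    (W : WeierstrassCurve ℚ) [W.IsElliptic] [W.IsGloballyMinimal] [Fact (3 : ℕ).Prime] (hO6 : ClassO6 W 3)
    (hred : ¬ W.HasIrreducibleModPGaloisRep 3) (hr : W.analyticRank = 0) :
    MissingUpperBoundAt W 3 :=
  missingUpperBoundAt_of_fineInputs_of_potentiallySupersingular hmod hF hH hLim hFW hCassels hGZK hmodL W 3 (by decide)
    hO6.2.1.1 hO6.2.1.2 hO6.padicValRat_j_nonneg hred hr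
    (fun _F _ _ _w hw hgood ↦
      not_hasUnitRootAt_baseChange_of_not_typeG_three W hO6.2.1 hO6.not_typeG_three.1 hw hgood)

/-- **Crux M's row conclusion on EVERY K8-t′ row (odd additive `p` of census cell (t′)) from {modularity, Fine, H2X⁺, Lim, FW} —
NO Imai, NO 27962** (`Addv ∧ SubTprime ⊆ ClassO5`: `ord_p j ≥ 0` and potentially supersingular by
`not_hasUnitRootAt_baseChange_of_classO5`). This is exactly what `TameRankZeroAssembly` consumes of M.
[cite: Kato2004Asterisque, Prop. 14.16 (2) (pp. 244–245), Thm. 12.6 (p. 222)] [cite: Serre1967GroupesPDivisibles, §5 Prop. 8]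
[cite: Delbourgo1998, §1.5 (G) and Thm. 1 p. 152] -/
theorem katoMemberShaBound_at_of_fineInputs_of_subTprime (hmod : exists_isNewformOf)
    (hF : exists_memberHullZetaFineInputs) (hH : exists_iwasawaH2Data_fineSelmerDual_embedding_count)
    (hLim : Lim2017.thm35_fineSelmerDual_moduleFinite_of_classicalMuVanishes_of_le_divisionField)
    (hFW : Literature.NumberTheory.IwasawaTheory.ferreroWashington1979_classicalMuVanishes)
    (W : WeierstrassCurve ℚ) [W.IsElliptic] [W.IsGloballyMinimal] (p : ℕ) [Fact p.Prime] (hp : p ≠ 2)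
    (hadd : Addv W p) (hT : SubTprime W p)
    (hred : ¬ W.HasIrreducibleModPGaloisRep p) (hL : W.entireLFunction 1 ≠ 0) (hsha : Finite W.sha) :
    ∃ (W' : WeierstrassCurve ℚ) (_ : W'.IsElliptic) (_ : W'.IsGloballyMinimal),
      IsIsogenous W W' ∧ Finite W'.sha ∧
      ∃ q : ℚ, W'.entireLFunction 1 / (W'.realPeriodRat : ℂ) = (q : ℂ) ∧
        (padicValNat p (Nat.card (AddCommGroup.primaryComponent W'.sha p)) : ℤ) +
            padicValNat p W'.tamagawaProduct ≤
          padicValRat p q + 3 * (padicValNat p W'.torsionOrder : ℤ) :=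
  have hO5 : ClassO5 W p := ⟨hp, hadd, Or.inr hT⟩
  katoMemberShaBound_at_of_fineInputs_of_potentiallySupersingular hmod hF hH hLim hFW W p hp
    hadd.1 hadd.2 hO5.padicValRat_j_nonneg hred hL hsha
    (fun _F _ _ _w hw hgood ↦ not_hasUnitRootAt_baseChange_of_classO5 W p hO5 hw hgood)

/-- **U₀-red's `MissingUpperBoundAt W p` on EVERY K8-t′ row of analytic rank `0` with `W[p]` reducible, from {modularity, Fine,
H2X⁺, Lim, FW} + Cassels / GZK / entire `L` — NO Imai, NO 27962.** [cite: Kato2004Asterisque, proof of Prop. 14.16 (pp. 244–245)]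
[cite: Serre1967GroupesPDivisibles, §5 Prop. 8] [cite: Cassels1965ArithmeticVIII] -/
theorem missingUpperBoundAt_of_fineInputs_of_subTprime (hmod : exists_isNewformOf)
    (hF : exists_memberHullZetaFineInputs) (hH : exists_iwasawaH2Data_fineSelmerDual_embedding_count)
    (hLim : Lim2017.thm35_fineSelmerDual_moduleFinite_of_classicalMuVanishes_of_le_divisionField)
    (hFW : Literature.NumberTheory.IwasawaTheory.ferreroWashington1979_classicalMuVanishes)
    (hCassels : bsdRHS_eq_of_isIsogenous) (hGZK : rank_eq_analyticRank_of_analyticRank_le_one)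
    (hmodL : hasEntireLFunction_rat)
    (W : WeierstrassCurve ℚ) [W.IsElliptic] [W.IsGloballyMinimal] (p : ℕ) [Fact p.Prime] (hp : p ≠ 2)
    (hadd : Addv W p) (hT : SubTprime W p)
    (hred : ¬ W.HasIrreducibleModPGaloisRep p) (hr : W.analyticRank = 0) :
    MissingUpperBoundAt W p :=
  have hO5 : ClassO5 W p := ⟨hp, hadd, Or.inr hT⟩
  missingUpperBoundAt_of_fineInputs_of_potentiallySupersingular hmod hF hH hLim hFW hCassels hGZK hmodL W p hp
    hadd.1 hadd.2 hO5.padicValRat_j_nonneg hred hr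
    (fun _F _ _ _w hw hgood ↦ not_hasUnitRootAt_baseChange_of_classO5 W p hO5 hw hgood)

end Summit.BirchSwinnertonDyer.BirchSwinnertonDyer.Theorems.FineInputsPotSupersingular

end
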